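import Literature.Algebra.Lie.LefschetzTripleSubdirect
import Literature.Algebra.Lie.LefschetzTripleIdealsTensorFactors
import Literature.Algebra.Lie.LefschetzModuleTensor
import Literature.Algebra.Lie.LefschetzModulePolarization
import HarnessLib

/-!
# Lefschetz modules of ONE `𝔞` are closed under direct sums and tensor products (Looijenga–Lunts 1997, §1 p. 4)

Topic `Literature/Algebra/Lie` (namespace `Literature.Algebra.Lie`).  Lane `lit-hodgefound` (Track 2 foundations
library), skeleton seat `lit-hodgefound-skel-1` (generation 45), row **A1-141** of
`run/shared/lean/pub/lit-hodgefound/SKELETON.md`: the MODULE-LEVEL form of row A1-140 (`LefschetzTripleSubdirect.lean`: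
one `𝔞` in two Lefschetz triples gives the Lefschetz triple `𝔤(𝔠, ·) ≤ 𝔤' × 𝔤''`, a subdirect product), through A1-137
`IsLefschetzTriple.isLefschetzModule_of_lieHom` (a representation of a Lefschetz triple is a Lefschetz module whose Lie
algebra is the image) and the two representations `(x, y) ↦ x ⊕ y` (A1-99 `prodLieHom`) and `(x, y) ↦ x ⊗ 1 + 1 ⊗ y`
(A1-104 `tensorLieHom`) of `𝔤(𝔞, M') × 𝔤(𝔞, M'')`.  DEFINITIONS WITH BODIES (the structure maps `diagProdRep`,
`diagTensorRep` of one `𝔞` acting on `M' ⊕ M''`, `M' ⊗ M''`, and `toLefschetzLieAlgebra`, the structure map viewed in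
`𝔤(𝔞, M)`) and PROVED theorems; no named fact, no `sorry`, no instance, no notation (D-0026 net debt `0`).  The
commutator Lie ring of `𝔤𝔩(·) = Module.End K ·` is Mathlib's reducible non-instance `LieRing.ofAssociativeRing`, enabled
FILE-LOCALLY exactly as in every parent of the series (`LefschetzModule.lean`, …).

## Source, VERBATIM

E. Looijenga, V. A. Lunts, *A Lie algebra attached to a projective variety*, Invent. Math. **129** (1997) 361–412,
§1 (held TeX text `paper:arxiv-alg-geom_9604014`), p0004 L28–L41 and L62–L64:

> "Now let `𝔞` be a finite dimensional `K`-vector space. We regard `𝔞` as a graded abelian Lie algebra which is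
> homogeneous of degree two. We say that a graded Lie homomorphism `e : 𝔞 → 𝔤𝔩(M)` has the Lefschetz property if for
> some `a ∈ 𝔞`, `e_a` has that property. […] We let `𝔤(𝔞, M)` denote the Lie subalgebra of `𝔤𝔩(M)` generated by the
> transformations `e_a, f_a`. If `𝔞` is merely an abelian group that acts on `M` by operators of degree `2`, then the
> linear extension `𝔞 ⊗ K → 𝔤𝔩(M)` is a Lie homomorphism and we then often write `𝔤(𝔞, M)` for `𝔤(𝔞 ⊗ K, M)`."
> "The collection of Lefschetz modules is closed under direct sums, tensor products and taking duals."

## Rendering (dictionary, continuing A1-88)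

* The structure map "`e : 𝔞 → 𝔤𝔩(M)`" is a linear map `ρ : A →ₗ[K] 𝔤𝔩(M)` on a `K`-module `A` ("`𝔞`", or "`𝔞 ⊗ K`" for
  an abelian group `𝔞`); A1-88's `IsLefschetzModule K h 𝔞` takes `𝔞 :=` the image `LinearMap.range ρ` (TODO(general form)
  of A1-88, realised here: `𝔤(𝔞, M)` depends only on the image).  "`(𝔞, M)` is a Lefschetz module" =
  `IsLefschetzModule K h (LinearMap.range ρ)`.
* The direct sum `(𝔞, M' ⊕ M'')` of two Lefschetz modules OF THE SAME `𝔞` — `e_a (m', m'') = (e'_a m', e''_a m'')` — has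
  structure map **`diagProdRep ρ' ρ'' : a ↦ e'_a ⊕ e''_a`** (`LinearMap.prodMap`) and degree operator `h' ⊕ h''`; the tensor
  product `(𝔞, M' ⊗ M'')` — `e_a (m' ⊗ m'') = e'_a m' ⊗ m'' + m' ⊗ e''_a m''` — has **`diagTensorRep ρ' ρ'' : a ↦ e'_a ⊗ 1 + 1 ⊗ e''_a`**
  and degree operator `h' ⊗ 1 + 1 ⊗ h''` (A1-90).
* `toLefschetzLieAlgebra h ρ : A → 𝔤(𝔞, M)` is `ρ` with values in `𝔤(𝔞, M) ∋ e_a`; the "common `𝔞`" of A1-140 is the image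
  `𝔠 = {(e'_a, e''_a)} ≤ 𝔤(𝔞, M') × 𝔤(𝔞, M'')` of `(toLefschetzLieAlgebra h' ρ').prod (toLefschetzLieAlgebra h'' ρ'')`.

## Contents (all proved)

* §1 `diagProdRep`, `diagTensorRep`, `toLefschetzLieAlgebra` (+ `_apply` / `coe_…_apply` lemmas), `map_fst_range_prod_toLefschetzLieAlgebra`
  / `map_snd_…` (the common `𝔠` projects onto both copies of `𝔞`).
* §2 the ENGINE **`IsLefschetzModule.isLefschetzModule_lieHom_prod`**: for Lefschetz modules `(𝔞, M')`, `(𝔞, M'')` and any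
  Lie homomorphism `Φ : 𝔤(𝔞, M') × 𝔤(𝔞, M'') → 𝔤𝔩(V)` with `Φ(h', h'') ≠ 0`, `(Φ 𝔠, V)` is a Lefschetz module with
  `𝔤(Φ 𝔠, V) = Φ(𝔤(𝔠, ·))`, where `𝔤(𝔠, ·)` projects onto `𝔤(𝔞, M')` and onto `𝔤(𝔞, M'')` (A1-140 + A1-137).
* §3 **`IsLefschetzModule.isLefschetzModule_diagProd`**: `(𝔞, M' ⊕ M'')` is a Lefschetz module; `lefschetzLieAlgebra_diagProd_le` (`𝔤(𝔞, M' ⊕ M'')`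
  is block-diagonal with blocks in `𝔤(𝔞, M')`, `𝔤(𝔞, M'')`) and **`exists_prodMap_mem_lefschetzLieAlgebra_diagProd`** /
  `exists_prodMap_mem_…'` (every `x ∈ 𝔤(𝔞, M')` is the first block of an element of `𝔤(𝔞, M' ⊕ M'')`: the projections are ONTO).
* §4 **`IsLefschetzModule.isLefschetzModule_diagTensor`** (`M'' ≠ 0`): `(𝔞, M' ⊗ M'')` is a Lefschetz module; `lefschetzLieAlgebra_diagTensor_le`,
  **`exists_rTensor_add_lTensor_mem_lefschetzLieAlgebra_diagTensor`** / `…'`.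
* §5 (rider) MORPHISMS of Lefschetz `𝔞`-modules ("as Lefschetz `𝔞`-modules", p0004 L98–L100): a linear map `φ : M' → M''` with
  `φ h' = h'' φ`, `φ e'_a = e''_a φ` intertwines every `x' ⊕ x'' ∈ 𝔤(𝔞, M' ⊕ M'')`
  (**`comp_eq_comp_of_prodMap_mem_lefschetzLieAlgebra_diagProd`**, no Lefschetz hypothesis; the graph operator of `φ`
  commutes with `𝔞 ⊕ 𝔞`, hence with `𝔤(𝔞, M' ⊕ M'')` by A1-96 `commute_of_mem_lefschetzLieAlgebra`), hence every pair of
  the common Lie algebra `𝔤(𝔠, ·)` (**`IsLefschetzModule.comp_eq_comp_of_mem_lefschetzLieAlgebra_common`**,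
  `exists_comp_eq_comp` / `…'`); `ker φ`, `im φ` are `𝔤(𝔞, ·)`-submodules (`apply_mem_ker/range_of_mem_lefschetzLieAlgebra`);
  and the grading-free naturality of partners `comp_eq_comp_of_isSl2Triple_of_comp_eq` (cf. `Sl2Intertwiner.lean`, which
  assumes `ℤ`-gradings).

## SCOPE (what is NOT formalised here)

(a) "taking duals" for one `𝔞` is A1-112 (`LefschetzModuleDual.lean`) verbatim (the dual of `(𝔞, M)` has the same `𝔞`).
(b) `𝔤(𝔞, M' ⊕ M'')` is identified as a SUBDIRECT product of `𝔤(𝔞, M')`, `𝔤(𝔞, M'')` (blocks + surjective projections), not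
computed further (for `M'' = M'` it is the diagonal copy of `𝔤(𝔞, M')`).  (c) Nothing here concerns complex tori or the
Hodge conjecture.

## References

* [LooijengaLunts1997] E. Looijenga, V. A. Lunts, *A Lie algebra attached to a projective variety*, Invent. Math. 129
  (1997) 361–412; arXiv:alg-geom/9604014. §1 p. 4 L28–L41, L62–L64 (held `paper:arxiv-alg-geom_9604014`).
-/

noncomputable section

namespace Literature.Algebra.Lie

open Module Function Set LieModule
open scoped TensorProduct

-- The commutator Lie ring of `𝔤𝔩(·) = Module.End K ·`: Mathlib's reducible NON-instance, enabled file-locally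
-- exactly as in `LefschetzModule.lean`.
attribute [local instance 100] LieRing.ofAssociativeRing

/-! ### §1 The structure maps of one `𝔞` on `M' ⊕ M''` and on `M' ⊗ M''` -/

section Defs

variable {K : Type*} [CommRing K] {A : Type*} [AddCommGroup A] [Module K A] {M N : Type*} [AddCommGroup M] [Module K M]
  [AddCommGroup N] [Module K N]

/-- **One `𝔞` acting on `M' ⊕ M''`**: `e_a (m', m'') = (e'_a m', e''_a m'')`, i.e. `a ↦ e'_a ⊕ e''_a` ("closed under direct
sums"). [cite: LooijengaLunts1997, §1 p0004 L62–L63, L78–L79] -/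
def diagProdRep (ρ₁ : A →ₗ[K] Module.End K M) (ρ₂ : A →ₗ[K] Module.End K N) : A →ₗ[K] Module.End K (M × N) where
  toFun a := (ρ₁ a).prodMap (ρ₂ a)
  map_add' a b := by rw [map_add, map_add, LinearMap.prodMap_add]
  map_smul' c a := by
    rw [map_smul, map_smul, RingHom.id_apply]
    ext x <;> simp

/-- `diagProdRep ρ' ρ'' a = e'_a ⊕ e''_a`. [cite: LooijengaLunts1997, §1 p0004 L78–L79] -/
@[simp] theorem diagProdRep_apply (ρ₁ : A →ₗ[K] Module.End K M) (ρ₂ : A →ₗ[K] Module.End K N) (a : A) :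
    diagProdRep ρ₁ ρ₂ a = (ρ₁ a).prodMap (ρ₂ a) := rfl

/-- **One `𝔞` acting on `M' ⊗ M''`**: `e_a (m' ⊗ m'') = e'_a m' ⊗ m'' + m' ⊗ e''_a m''`, i.e. `a ↦ e'_a ⊗ 1 + 1 ⊗ e''_a`
("closed under … tensor products"). [cite: LooijengaLunts1997, §1 p0004 L62–L63, L80–L82] -/
def diagTensorRep (ρ₁ : A →ₗ[K] Module.End K M) (ρ₂ : A →ₗ[K] Module.End K N) :
    A →ₗ[K] Module.End K (M ⊗[K] N) where
  toFun a := (ρ₁ a).rTensor N + (ρ₂ a).lTensor M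
  map_add' a b := by
    simp only [map_add, LinearMap.rTensor_add, LinearMap.lTensor_add]
    abel
  map_smul' c a := by
    simp only [map_smul, LinearMap.rTensor_smul, LinearMap.lTensor_smul, RingHom.id_apply, smul_add]

/-- `diagTensorRep ρ' ρ'' a = e'_a ⊗ 1 + 1 ⊗ e''_a`. [cite: LooijengaLunts1997, §1 p0004 L80–L82] -/
@[simp] theorem diagTensorRep_apply (ρ₁ : A →ₗ[K] Module.End K M) (ρ₂ : A →ₗ[K] Module.End K N) (a : A) :
    diagTensorRep ρ₁ ρ₂ a = (ρ₁ a).rTensor N + (ρ₂ a).lTensor M := rfl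

/-- The structure map `e : 𝔞 → 𝔤𝔩(M)` with values in `𝔤(𝔞, M) ∋ e_a`. [cite: LooijengaLunts1997, §1 p0004 L35–L37] -/
def toLefschetzLieAlgebra (h : Module.End K M) (ρ : A →ₗ[K] Module.End K M) :
    A →ₗ[K] lefschetzLieAlgebra K h (LinearMap.range ρ) :=
  LinearMap.codRestrict (lefschetzLieAlgebra K h (LinearMap.range ρ)).toSubmodule ρ fun a ↦
    le_lefschetzLieAlgebra (LinearMap.mem_range_self ρ a)

/-- `toLefschetzLieAlgebra h ρ a = e_a`. [cite: LooijengaLunts1997, §1 p0004 L35–L37] -/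
@[simp] theorem coe_toLefschetzLieAlgebra_apply (h : Module.End K M) (ρ : A →ₗ[K] Module.End K M) (a : A) :
    (toLefschetzLieAlgebra h ρ a : Module.End K M) = ρ a := rfl

/-- **The common `𝔠 = {(e'_a, e''_a)}` projects onto the copy of `𝔞` in `𝔤(𝔞, M')`.** [cite: LooijengaLunts1997, §1 p0004 L28–L37] -/
theorem map_fst_range_prod_toLefschetzLieAlgebra (h : Module.End K M) (h' : Module.End K N) (ρ₁ : A →ₗ[K] Module.End K M)
    (ρ₂ : A →ₗ[K] Module.End K N) :
    (LinearMap.range ((toLefschetzLieAlgebra h ρ₁).prod (toLefschetzLieAlgebra h' ρ₂))).map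
        (LinearMap.fst K _ _) = inSubalgebra (lefschetzLieAlgebra K h (LinearMap.range ρ₁)) (LinearMap.range ρ₁) := by
  ext x
  simp only [Submodule.mem_map, LinearMap.mem_range, LinearMap.fst_apply, mem_inSubalgebra_iff]
  constructor
  · rintro ⟨_, ⟨a, rfl⟩, rfl⟩
    exact ⟨a, rfl⟩
  · rintro ⟨a, ha⟩
    exact ⟨_, ⟨a, rfl⟩, Subtype.ext ha⟩

/-- … and onto the copy of `𝔞` in `𝔤(𝔞, M'')`. [cite: LooijengaLunts1997, §1 p0004 L28–L37] -/
theorem map_snd_range_prod_toLefschetzLieAlgebra (h : Module.End K M) (h' : Module.End K N) (ρ₁ : A →ₗ[K] Module.End K M)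
    (ρ₂ : A →ₗ[K] Module.End K N) :
    (LinearMap.range ((toLefschetzLieAlgebra h ρ₁).prod (toLefschetzLieAlgebra h' ρ₂))).map
        (LinearMap.snd K _ _) = inSubalgebra (lefschetzLieAlgebra K h' (LinearMap.range ρ₂)) (LinearMap.range ρ₂) := by
  ext x
  simp only [Submodule.mem_map, LinearMap.mem_range, LinearMap.snd_apply, mem_inSubalgebra_iff]
  constructor
  · rintro ⟨_, ⟨a, rfl⟩, rfl⟩
    exact ⟨a, rfl⟩
  · rintro ⟨a, ha⟩
    exact ⟨_, ⟨a, rfl⟩, Subtype.ext ha⟩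

end Defs

/-! ### §2 The engine: any representation `Φ` of `𝔤(𝔞, M') × 𝔤(𝔞, M'')` with `Φ(h', h'') ≠ 0` -/

section Engine

variable {K : Type*} [Field K] [CharZero K] {A : Type*} [AddCommGroup A] [Module K A]
  {M N : Type*} [AddCommGroup M] [Module K M] [FiniteDimensional K M] [AddCommGroup N] [Module K N]
  [FiniteDimensional K N] {h : Module.End K M} {h' : Module.End K N}
  {ρ₁ : A →ₗ[K] Module.End K M} {ρ₂ : A →ₗ[K] Module.End K N}

/-- **ENGINE.**  Let `(𝔞, M')`, `(𝔞, M'')` be Lefschetz modules of one `𝔞` (structure maps `ρ'`, `ρ''`) and let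
`Φ : 𝔤(𝔞, M') × 𝔤(𝔞, M'') → 𝔤𝔩(V)` be a Lie homomorphism with `Φ(h', h'') ≠ 0`.  Then `(Φ 𝔠, V)` — `𝔞` acting by
`a ↦ Φ(e'_a, e''_a)` — is a Lefschetz module, with `𝔤(Φ 𝔠, V) = Φ(𝔤(𝔠, ·))` for the Lefschetz triple
`𝔤(𝔠, ·) ≤ 𝔤(𝔞, M') × 𝔤(𝔞, M'')` of A1-140, which projects onto both factors. [cite: LooijengaLunts1997, §1 p0004 L62–L63 ("closed under direct sums, tensor products"), p0007 L66–L75 ("𝔤(𝔞, M) is just the image of 𝔤")] -/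
theorem IsLefschetzModule.isLefschetzModule_lieHom_prod (A₁ : IsLefschetzModule K h (LinearMap.range ρ₁))
    (A₂ : IsLefschetzModule K h' (LinearMap.range ρ₂)) {V : Type*} [AddCommGroup V] [Module K V] [FiniteDimensional K V]
    (Φ : lefschetzLieAlgebra K h (LinearMap.range ρ₁) × lefschetzLieAlgebra K h' (LinearMap.range ρ₂) →ₗ⁅K⁆ Module.End K V)
    (h0 : Φ (⟨h, A₁.h_mem⟩, ⟨h', A₂.h_mem⟩) ≠ 0) :
    IsLefschetzModule K (Φ (⟨h, A₁.h_mem⟩, ⟨h', A₂.h_mem⟩))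
        (LinearMap.range ((Φ : _ →ₗ[K] Module.End K V) ∘ₗ
          (toLefschetzLieAlgebra h ρ₁).prod (toLefschetzLieAlgebra h' ρ₂))) ∧
      lefschetzLieAlgebra K (Φ (⟨h, A₁.h_mem⟩, ⟨h', A₂.h_mem⟩))
          (LinearMap.range ((Φ : _ →ₗ[K] Module.End K V) ∘ₗ
            (toLefschetzLieAlgebra h ρ₁).prod (toLefschetzLieAlgebra h' ρ₂))) =
        (lefschetzLieAlgebra K ((⟨h, A₁.h_mem⟩, ⟨h', A₂.h_mem⟩) : lefschetzLieAlgebra K h (LinearMap.range ρ₁) ×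
            lefschetzLieAlgebra K h' (LinearMap.range ρ₂))
          (LinearMap.range ((toLefschetzLieAlgebra h ρ₁).prod (toLefschetzLieAlgebra h' ρ₂)))).map Φ ∧
      (lefschetzLieAlgebra K ((⟨h, A₁.h_mem⟩, ⟨h', A₂.h_mem⟩) : lefschetzLieAlgebra K h (LinearMap.range ρ₁) ×
            lefschetzLieAlgebra K h' (LinearMap.range ρ₂))
          (LinearMap.range ((toLefschetzLieAlgebra h ρ₁).prod (toLefschetzLieAlgebra h' ρ₂)))).map
        (LieHom.fst K _ _) = ⊤ ∧
      (lefschetzLieAlgebra K ((⟨h, A₁.h_mem⟩, ⟨h', A₂.h_mem⟩) : lefschetzLieAlgebra K h (LinearMap.range ρ₁) ×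
            lefschetzLieAlgebra K h' (LinearMap.range ρ₂))
          (LinearMap.range ((toLefschetzLieAlgebra h ρ₁).prod (toLefschetzLieAlgebra h' ρ₂)))).map
        (LieHom.snd K _ _) = ⊤ := by
  haveI : FiniteDimensional K (lefschetzLieAlgebra K h (LinearMap.range ρ₁)) :=
    inferInstanceAs (FiniteDimensional K (lefschetzLieAlgebra K h (LinearMap.range ρ₁)).toSubmodule)
  haveI : FiniteDimensional K (lefschetzLieAlgebra K h' (LinearMap.range ρ₂)) :=
    inferInstanceAs (FiniteDimensional K (lefschetzLieAlgebra K h' (LinearMap.range ρ₂)).toSubmodule)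
  set 𝔠 := LinearMap.range ((toLefschetzLieAlgebra h ρ₁).prod (toLefschetzLieAlgebra h' ρ₂)) with h𝔠
  have T₁ := A₁.isLefschetzTriple
  have T₂ := A₂.isLefschetzTriple
  have h𝔠₁ := map_fst_range_prod_toLefschetzLieAlgebra h h' ρ₁ ρ₂
  have h𝔠₂ := map_snd_range_prod_toLefschetzLieAlgebra h h' ρ₁ ρ₂
  have TD := isLefschetzTriple_lefschetzLieAlgebra_common T₁ T₂ h𝔠₁ h𝔠₂
  set D := lefschetzLieAlgebra K ((⟨h, A₁.h_mem⟩, ⟨h', A₂.h_mem⟩) : lefschetzLieAlgebra K h (LinearMap.range ρ₁) ×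
    lefschetzLieAlgebra K h' (LinearMap.range ρ₂)) 𝔠 with hD
  haveI : FiniteDimensional K D := inferInstanceAs (FiniteDimensional K D.toSubmodule)
  have hΦD := TD.isLefschetzModule_of_lieHom (Φ.comp D.incl) h0
  -- `Φ 𝔠` computed through `D`
  have h1 : (inSubalgebra D 𝔠).map ((Φ.comp D.incl : D →ₗ⁅K⁆ Module.End K V) : D →ₗ[K] Module.End K V) =
      LinearMap.range ((Φ : _ →ₗ[K] Module.End K V) ∘ₗ
        (toLefschetzLieAlgebra h ρ₁).prod (toLefschetzLieAlgebra h' ρ₂)) := by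
    ext x
    simp only [Submodule.mem_map, mem_inSubalgebra_iff, LinearMap.mem_range, LinearMap.comp_apply]
    constructor
    · rintro ⟨d, ⟨a, ha⟩, rfl⟩
      exact ⟨a, by rw [LieHom.coe_toLinearMap, ha]; rfl⟩
    · rintro ⟨a, rfl⟩
      refine ⟨⟨_, le_lefschetzLieAlgebra (LinearMap.mem_range_self _ a)⟩, ⟨a, rfl⟩, rfl⟩
  -- the image of `D`
  have h2 : (Φ.comp D.incl).range = D.map Φ := by
    ext x
    simp only [LieHom.mem_range, LieSubalgebra.mem_map, LieHom.comp_apply]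
    constructor
    · rintro ⟨d, rfl⟩
      exact ⟨d, d.2, rfl⟩
    · rintro ⟨y, hy, rfl⟩
      exact ⟨⟨y, hy⟩, rfl⟩
  rw [h1, h2] at hΦD
  exact ⟨hΦD.1, hΦD.2, map_fst_lefschetzLieAlgebra_common_eq_top T₁ T₂ h𝔠₁ h𝔠₂,
    map_snd_lefschetzLieAlgebra_common_eq_top T₁ T₂ h𝔠₁ h𝔠₂⟩

end Engine

/-! ### §3 Direct sums: `(𝔞, M' ⊕ M'')` is a Lefschetz module -/

section DirectSum

variable {K : Type*} [Field K] [CharZero K] {A : Type*} [AddCommGroup A] [Module K A]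
  {M N : Type*} [AddCommGroup M] [Module K M] [FiniteDimensional K M] [AddCommGroup N] [Module K N]
  [FiniteDimensional K N] {h : Module.End K M} {h' : Module.End K N}
  {ρ₁ : A →ₗ[K] Module.End K M} {ρ₂ : A →ₗ[K] Module.End K N}

omit [CharZero K] [FiniteDimensional K M] [FiniteDimensional K N] in
/-- The block-diagonal representation composed with the common structure map is `diagProdRep`.
[cite: LooijengaLunts1997, §1 p0004 L78–L79] -/
theorem prodLieHom_comp_prod_toLefschetzLieAlgebra :
    ((prodLieHom K (lefschetzLieAlgebra K h (LinearMap.range ρ₁)) (lefschetzLieAlgebra K h' (LinearMap.range ρ₂)) :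
        _ →ₗ[K] Module.End K (M × N)) ∘ₗ (toLefschetzLieAlgebra h ρ₁).prod (toLefschetzLieAlgebra h' ρ₂)) =
      diagProdRep ρ₁ ρ₂ := by
  ext a : 1
  rfl

/-- **"Closed under direct sums" for one `𝔞`: if `(𝔞, M')` and `(𝔞, M'')` are Lefschetz modules then so is
`(𝔞, M' ⊕ M'')`**, `𝔞` acting by `e_a (m', m'') = (e'_a m', e''_a m'')` and graded by `h' ⊕ h''` — with `𝔤(𝔞, M' ⊕ M'')`
semisimple as a subdirect product of `𝔤(𝔞, M')`, `𝔤(𝔞, M'')` (A1-140). [cite: LooijengaLunts1997, §1 p0004 L62–L63] -/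
theorem IsLefschetzModule.isLefschetzModule_diagProd (A₁ : IsLefschetzModule K h (LinearMap.range ρ₁))
    (A₂ : IsLefschetzModule K h' (LinearMap.range ρ₂)) :
    IsLefschetzModule K (h.prodMap h') (LinearMap.range (diagProdRep ρ₁ ρ₂)) := by
  have h0 : prodLieHom K (lefschetzLieAlgebra K h (LinearMap.range ρ₁)) (lefschetzLieAlgebra K h' (LinearMap.range ρ₂))
      (⟨h, A₁.h_mem⟩, ⟨h', A₂.h_mem⟩) ≠ 0 := by
    intro h1
    apply A₁.h_ne_zero
    ext m
    simpa [prodLieHom_apply] using congrArg (fun g : Module.End K (M × N) ↦ (g (m, 0)).1) h1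
  have H := (A₁.isLefschetzModule_lieHom_prod A₂ _ h0).1
  rwa [prodLieHom_comp_prod_toLefschetzLieAlgebra] at H

/-- `𝔤(𝔞, M' ⊕ M'')` is the image of the Lefschetz triple `𝔤(𝔠, ·) ≤ 𝔤(𝔞, M') × 𝔤(𝔞, M'')` under `(x, y) ↦ x ⊕ y`.
[cite: LooijengaLunts1997, §1 p0004 L62–L63, p0007 L66–L75] -/
theorem IsLefschetzModule.lefschetzLieAlgebra_diagProd_eq (A₁ : IsLefschetzModule K h (LinearMap.range ρ₁))
    (A₂ : IsLefschetzModule K h' (LinearMap.range ρ₂)) :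
    lefschetzLieAlgebra K (h.prodMap h') (LinearMap.range (diagProdRep ρ₁ ρ₂)) =
      (lefschetzLieAlgebra K ((⟨h, A₁.h_mem⟩, ⟨h', A₂.h_mem⟩) : lefschetzLieAlgebra K h (LinearMap.range ρ₁) ×
            lefschetzLieAlgebra K h' (LinearMap.range ρ₂))
          (LinearMap.range ((toLefschetzLieAlgebra h ρ₁).prod (toLefschetzLieAlgebra h' ρ₂)))).map
        (prodLieHom K (lefschetzLieAlgebra K h (LinearMap.range ρ₁)) (lefschetzLieAlgebra K h' (LinearMap.range ρ₂))) := by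
  have h0 : prodLieHom K (lefschetzLieAlgebra K h (LinearMap.range ρ₁)) (lefschetzLieAlgebra K h' (LinearMap.range ρ₂))
      (⟨h, A₁.h_mem⟩, ⟨h', A₂.h_mem⟩) ≠ 0 := by
    intro h1
    apply A₁.h_ne_zero
    ext m
    simpa [prodLieHom_apply] using congrArg (fun g : Module.End K (M × N) ↦ (g (m, 0)).1) h1
  have H := (A₁.isLefschetzModule_lieHom_prod A₂ _ h0).2.1
  rwa [prodLieHom_comp_prod_toLefschetzLieAlgebra] at H

/-- `𝔤(𝔞, M' ⊕ M'')` is block-diagonal with blocks in `𝔤(𝔞, M')` and `𝔤(𝔞, M'')`. [cite: LooijengaLunts1997, §1 p0004 L62–L63, L86–L87] -/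
theorem IsLefschetzModule.lefschetzLieAlgebra_diagProd_le (A₁ : IsLefschetzModule K h (LinearMap.range ρ₁))
    (A₂ : IsLefschetzModule K h' (LinearMap.range ρ₂)) :
    lefschetzLieAlgebra K (h.prodMap h') (LinearMap.range (diagProdRep ρ₁ ρ₂)) ≤
      (prodLieHom K (lefschetzLieAlgebra K h (LinearMap.range ρ₁)) (lefschetzLieAlgebra K h' (LinearMap.range ρ₂))).range := by
  rw [A₁.lefschetzLieAlgebra_diagProd_eq A₂]
  intro z hz
  obtain ⟨d, -, rfl⟩ := (LieSubalgebra.mem_map _ _ _).1 hz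
  exact LieHom.mem_range_self _ d

/-- **The first projection of `𝔤(𝔞, M' ⊕ M'')` is ONTO `𝔤(𝔞, M')`**: every `x ∈ 𝔤(𝔞, M')` is the first block of some
`x ⊕ y ∈ 𝔤(𝔞, M' ⊕ M'')` with `y ∈ 𝔤(𝔞, M'')` (generic generation, A1-139/A1-140).
[cite: LooijengaLunts1997, §1 p0004 L62–L63, L86–L87] -/
theorem IsLefschetzModule.exists_prodMap_mem_lefschetzLieAlgebra_diagProd (A₁ : IsLefschetzModule K h (LinearMap.range ρ₁))
    (A₂ : IsLefschetzModule K h' (LinearMap.range ρ₂)) {x : Module.End K M}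
    (hx : x ∈ lefschetzLieAlgebra K h (LinearMap.range ρ₁)) :
    ∃ y ∈ lefschetzLieAlgebra K h' (LinearMap.range ρ₂),
      x.prodMap y ∈ lefschetzLieAlgebra K (h.prodMap h') (LinearMap.range (diagProdRep ρ₁ ρ₂)) := by
  have h0 : prodLieHom K (lefschetzLieAlgebra K h (LinearMap.range ρ₁)) (lefschetzLieAlgebra K h' (LinearMap.range ρ₂))
      (⟨h, A₁.h_mem⟩, ⟨h', A₂.h_mem⟩) ≠ 0 := by
    intro h1
    apply A₁.h_ne_zero
    ext m
    simpa [prodLieHom_apply] using congrArg (fun g : Module.End K (M × N) ↦ (g (m, 0)).1) h1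
  obtain ⟨-, hEq, hfst, -⟩ := A₁.isLefschetzModule_lieHom_prod A₂ _ h0
  rw [prodLieHom_comp_prod_toLefschetzLieAlgebra] at hEq
  have hx' : (⟨x, hx⟩ : lefschetzLieAlgebra K h (LinearMap.range ρ₁)) ∈
      (⊤ : LieSubalgebra K (lefschetzLieAlgebra K h (LinearMap.range ρ₁))) := LieSubalgebra.mem_top _
  rw [← hfst, LieSubalgebra.mem_map] at hx'
  obtain ⟨d, hd, hd1⟩ := hx'
  refine ⟨(d.2 : Module.End K N), d.2.2, ?_⟩
  rw [show lefschetzLieAlgebra K (h.prodMap h') (LinearMap.range (diagProdRep ρ₁ ρ₂)) = _ from hEq,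
    LieSubalgebra.mem_map]
  refine ⟨d, hd, ?_⟩
  rw [prodLieHom_apply, show ((d.1 : lefschetzLieAlgebra K h (LinearMap.range ρ₁)) : Module.End K M) = x from
    congrArg Subtype.val hd1]

/-- … and the second projection is ONTO `𝔤(𝔞, M'')`. [cite: LooijengaLunts1997, §1 p0004 L62–L63, L86–L87] -/
theorem IsLefschetzModule.exists_prodMap_mem_lefschetzLieAlgebra_diagProd' (A₁ : IsLefschetzModule K h (LinearMap.range ρ₁))
    (A₂ : IsLefschetzModule K h' (LinearMap.range ρ₂)) {y : Module.End K N}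
    (hy : y ∈ lefschetzLieAlgebra K h' (LinearMap.range ρ₂)) :
    ∃ x ∈ lefschetzLieAlgebra K h (LinearMap.range ρ₁),
      x.prodMap y ∈ lefschetzLieAlgebra K (h.prodMap h') (LinearMap.range (diagProdRep ρ₁ ρ₂)) := by
  have h0 : prodLieHom K (lefschetzLieAlgebra K h (LinearMap.range ρ₁)) (lefschetzLieAlgebra K h' (LinearMap.range ρ₂))
      (⟨h, A₁.h_mem⟩, ⟨h', A₂.h_mem⟩) ≠ 0 := by
    intro h1
    apply A₁.h_ne_zero
    ext m
    simpa [prodLieHom_apply] using congrArg (fun g : Module.End K (M × N) ↦ (g (m, 0)).1) h1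
  obtain ⟨-, hEq, -, hsnd⟩ := A₁.isLefschetzModule_lieHom_prod A₂ _ h0
  rw [prodLieHom_comp_prod_toLefschetzLieAlgebra] at hEq
  have hy' : (⟨y, hy⟩ : lefschetzLieAlgebra K h' (LinearMap.range ρ₂)) ∈
      (⊤ : LieSubalgebra K (lefschetzLieAlgebra K h' (LinearMap.range ρ₂))) := LieSubalgebra.mem_top _
  rw [← hsnd, LieSubalgebra.mem_map] at hy'
  obtain ⟨d, hd, hd2⟩ := hy'
  refine ⟨(d.1 : Module.End K M), d.1.2, ?_⟩
  rw [show lefschetzLieAlgebra K (h.prodMap h') (LinearMap.range (diagProdRep ρ₁ ρ₂)) = _ from hEq,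
    LieSubalgebra.mem_map]
  refine ⟨d, hd, ?_⟩
  rw [prodLieHom_apply, show ((d.2 : lefschetzLieAlgebra K h' (LinearMap.range ρ₂)) : Module.End K N) = y from
    congrArg Subtype.val hd2]

end DirectSum

/-! ### §4 Tensor products: `(𝔞, M' ⊗ M'')` is a Lefschetz module -/

section Tensor

variable {K : Type*} [Field K] [CharZero K] {A : Type*} [AddCommGroup A] [Module K A]
  {M N : Type*} [AddCommGroup M] [Module K M] [FiniteDimensional K M] [AddCommGroup N] [Module K N]
  [FiniteDimensional K N] {h : Module.End K M} {h' : Module.End K N}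
  {ρ₁ : A →ₗ[K] Module.End K M} {ρ₂ : A →ₗ[K] Module.End K N}

omit [CharZero K] [FiniteDimensional K M] [FiniteDimensional K N] in
/-- The representation `(x, y) ↦ x ⊗ 1 + 1 ⊗ y` composed with the common structure map is `diagTensorRep`.
[cite: LooijengaLunts1997, §1 p0004 L80–L82] -/
theorem tensorLieHom_comp_prod_toLefschetzLieAlgebra :
    ((tensorLieHom K (lefschetzLieAlgebra K h (LinearMap.range ρ₁)) (lefschetzLieAlgebra K h' (LinearMap.range ρ₂)) :
        _ →ₗ[K] Module.End K (M ⊗[K] N)) ∘ₗ (toLefschetzLieAlgebra h ρ₁).prod (toLefschetzLieAlgebra h' ρ₂)) =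
      diagTensorRep ρ₁ ρ₂ := by
  ext a : 1
  rfl

omit [FiniteDimensional K M] [FiniteDimensional K N] in
/-- `h' ⊗ 1 + 1 ⊗ h'' ≠ 0` for Lefschetz modules `(𝔞, M')`, `(𝔞, M'')` with `M'' ≠ 0` (A1-104
`rTensor_add_lTensor_ne_zero`). [cite: LooijengaLunts1997, §1 p0004 L88 ("if both factors are nonzero")] -/
theorem IsLefschetzModule.tensorLieHom_h_ne_zero [Nontrivial N] (A₁ : IsLefschetzModule K h (LinearMap.range ρ₁))
    (A₂ : IsLefschetzModule K h' (LinearMap.range ρ₂)) :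
    tensorLieHom K (lefschetzLieAlgebra K h (LinearMap.range ρ₁)) (lefschetzLieAlgebra K h' (LinearMap.range ρ₂))
      (⟨h, A₁.h_mem⟩, ⟨h', A₂.h_mem⟩) ≠ 0 := by
  obtain ⟨a, -, fa, t⟩ := A₁.nonempty_lefschetzDomain
  rw [tensorLieHom_apply]
  exact rTensor_add_lTensor_ne_zero t A₂.isZGrading

/-- **"Closed under tensor products" for one `𝔞`: if `(𝔞, M')` and `(𝔞, M'')` (`M'' ≠ 0`) are Lefschetz modules then so
is `(𝔞, M' ⊗ M'')`**, `𝔞` acting by `e_a (m' ⊗ m'') = e'_a m' ⊗ m'' + m' ⊗ e''_a m''` and graded by `h' ⊗ 1 + 1 ⊗ h''` —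
with `𝔤(𝔞, M' ⊗ M'')` semisimple as the image of the subdirect product `𝔤(𝔠, ·)` (A1-140).
[cite: LooijengaLunts1997, §1 p0004 L62–L63] -/
theorem IsLefschetzModule.isLefschetzModule_diagTensor [Nontrivial N] (A₁ : IsLefschetzModule K h (LinearMap.range ρ₁))
    (A₂ : IsLefschetzModule K h' (LinearMap.range ρ₂)) :
    IsLefschetzModule K (h.rTensor N + h'.lTensor M) (LinearMap.range (diagTensorRep ρ₁ ρ₂)) := by
  have H := (A₁.isLefschetzModule_lieHom_prod A₂ _ (A₁.tensorLieHom_h_ne_zero A₂)).1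
  rwa [tensorLieHom_comp_prod_toLefschetzLieAlgebra] at H

/-- `𝔤(𝔞, M' ⊗ M'')` is the image of the Lefschetz triple `𝔤(𝔠, ·) ≤ 𝔤(𝔞, M') × 𝔤(𝔞, M'')` under
`(x, y) ↦ x ⊗ 1 + 1 ⊗ y`. [cite: LooijengaLunts1997, §1 p0004 L62–L63, p0007 L66–L75] -/
theorem IsLefschetzModule.lefschetzLieAlgebra_diagTensor_eq [Nontrivial N] (A₁ : IsLefschetzModule K h (LinearMap.range ρ₁))
    (A₂ : IsLefschetzModule K h' (LinearMap.range ρ₂)) :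
    lefschetzLieAlgebra K (h.rTensor N + h'.lTensor M) (LinearMap.range (diagTensorRep ρ₁ ρ₂)) =
      (lefschetzLieAlgebra K ((⟨h, A₁.h_mem⟩, ⟨h', A₂.h_mem⟩) : lefschetzLieAlgebra K h (LinearMap.range ρ₁) ×
            lefschetzLieAlgebra K h' (LinearMap.range ρ₂))
          (LinearMap.range ((toLefschetzLieAlgebra h ρ₁).prod (toLefschetzLieAlgebra h' ρ₂)))).map
        (tensorLieHom K (lefschetzLieAlgebra K h (LinearMap.range ρ₁)) (lefschetzLieAlgebra K h' (LinearMap.range ρ₂))) := by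
  have H := (A₁.isLefschetzModule_lieHom_prod A₂ _ (A₁.tensorLieHom_h_ne_zero A₂)).2.1
  rwa [tensorLieHom_comp_prod_toLefschetzLieAlgebra] at H

/-- `𝔤(𝔞, M' ⊗ M'') ⊆ {x ⊗ 1 + 1 ⊗ y | x ∈ 𝔤(𝔞, M'), y ∈ 𝔤(𝔞, M'')}`. [cite: LooijengaLunts1997, §1 p0004 L62–L63, L86–L88] -/
theorem IsLefschetzModule.lefschetzLieAlgebra_diagTensor_le [Nontrivial N] (A₁ : IsLefschetzModule K h (LinearMap.range ρ₁))
    (A₂ : IsLefschetzModule K h' (LinearMap.range ρ₂)) :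
    lefschetzLieAlgebra K (h.rTensor N + h'.lTensor M) (LinearMap.range (diagTensorRep ρ₁ ρ₂)) ≤
      (tensorLieHom K (lefschetzLieAlgebra K h (LinearMap.range ρ₁)) (lefschetzLieAlgebra K h' (LinearMap.range ρ₂))).range := by
  rw [A₁.lefschetzLieAlgebra_diagTensor_eq A₂]
  intro z hz
  obtain ⟨d, -, rfl⟩ := (LieSubalgebra.mem_map _ _ _).1 hz
  exact LieHom.mem_range_self _ d

/-- **The first component of `𝔤(𝔞, M' ⊗ M'')` is ONTO `𝔤(𝔞, M')`**: every `x ∈ 𝔤(𝔞, M')` occurs as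
`x ⊗ 1 + 1 ⊗ y ∈ 𝔤(𝔞, M' ⊗ M'')` for some `y ∈ 𝔤(𝔞, M'')`. [cite: LooijengaLunts1997, §1 p0004 L62–L63, L86–L88] -/
theorem IsLefschetzModule.exists_rTensor_add_lTensor_mem_lefschetzLieAlgebra_diagTensor [Nontrivial N]
    (A₁ : IsLefschetzModule K h (LinearMap.range ρ₁)) (A₂ : IsLefschetzModule K h' (LinearMap.range ρ₂))
    {x : Module.End K M} (hx : x ∈ lefschetzLieAlgebra K h (LinearMap.range ρ₁)) :
    ∃ y ∈ lefschetzLieAlgebra K h' (LinearMap.range ρ₂),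
      x.rTensor N + y.lTensor M ∈ lefschetzLieAlgebra K (h.rTensor N + h'.lTensor M) (LinearMap.range (diagTensorRep ρ₁ ρ₂)) := by
  obtain ⟨-, hEq, hfst, -⟩ := A₁.isLefschetzModule_lieHom_prod A₂ _ (A₁.tensorLieHom_h_ne_zero A₂)
  rw [tensorLieHom_comp_prod_toLefschetzLieAlgebra] at hEq
  have hx' : (⟨x, hx⟩ : lefschetzLieAlgebra K h (LinearMap.range ρ₁)) ∈
      (⊤ : LieSubalgebra K (lefschetzLieAlgebra K h (LinearMap.range ρ₁))) := LieSubalgebra.mem_top _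
  rw [← hfst, LieSubalgebra.mem_map] at hx'
  obtain ⟨d, hd, hd1⟩ := hx'
  refine ⟨(d.2 : Module.End K N), d.2.2, ?_⟩
  rw [show lefschetzLieAlgebra K (h.rTensor N + h'.lTensor M) (LinearMap.range (diagTensorRep ρ₁ ρ₂)) = _ from hEq,
    LieSubalgebra.mem_map]
  refine ⟨d, hd, ?_⟩
  rw [tensorLieHom_apply, show ((d.1 : lefschetzLieAlgebra K h (LinearMap.range ρ₁)) : Module.End K M) = x from
    congrArg Subtype.val hd1]

/-- … and the second component is ONTO `𝔤(𝔞, M'')`. [cite: LooijengaLunts1997, §1 p0004 L62–L63, L86–L88] -/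
theorem IsLefschetzModule.exists_rTensor_add_lTensor_mem_lefschetzLieAlgebra_diagTensor' [Nontrivial N]
    (A₁ : IsLefschetzModule K h (LinearMap.range ρ₁)) (A₂ : IsLefschetzModule K h' (LinearMap.range ρ₂))
    {y : Module.End K N} (hy : y ∈ lefschetzLieAlgebra K h' (LinearMap.range ρ₂)) :
    ∃ x ∈ lefschetzLieAlgebra K h (LinearMap.range ρ₁),
      x.rTensor N + y.lTensor M ∈ lefschetzLieAlgebra K (h.rTensor N + h'.lTensor M) (LinearMap.range (diagTensorRep ρ₁ ρ₂)) := by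
  obtain ⟨-, hEq, -, hsnd⟩ := A₁.isLefschetzModule_lieHom_prod A₂ _ (A₁.tensorLieHom_h_ne_zero A₂)
  rw [tensorLieHom_comp_prod_toLefschetzLieAlgebra] at hEq
  have hy' : (⟨y, hy⟩ : lefschetzLieAlgebra K h' (LinearMap.range ρ₂)) ∈
      (⊤ : LieSubalgebra K (lefschetzLieAlgebra K h' (LinearMap.range ρ₂))) := LieSubalgebra.mem_top _
  rw [← hsnd, LieSubalgebra.mem_map] at hy'
  obtain ⟨d, hd, hd2⟩ := hy'
  refine ⟨(d.1 : Module.End K M), d.1.2, ?_⟩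
  rw [show lefschetzLieAlgebra K (h.rTensor N + h'.lTensor M) (LinearMap.range (diagTensorRep ρ₁ ρ₂)) = _ from hEq,
    LieSubalgebra.mem_map]
  refine ⟨d, hd, ?_⟩
  rw [tensorLieHom_apply, show ((d.2 : lefschetzLieAlgebra K h' (LinearMap.range ρ₂)) : Module.End K N) = y from
    congrArg Subtype.val hd2]

/-- **A common Lefschetz element**: some `a ∈ 𝔞` has BOTH `e'_a` and `e''_a` Lefschetz (the Lefschetz locus of each
module is Zariski open, A1-111; module-level form of A1-140 `nonempty_lefschetzDomain_common`).
[cite: LooijengaLunts1997, §1 (1.1) p0004 L30–L32] -/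
theorem IsLefschetzModule.exists_hasLefschetzProperty_and (A₁ : IsLefschetzModule K h (LinearMap.range ρ₁))
    (A₂ : IsLefschetzModule K h' (LinearMap.range ρ₂)) :
    ∃ a : A, HasLefschetzProperty h (ρ₁ a) ∧ HasLefschetzProperty h' (ρ₂ a) := by
  haveI : FiniteDimensional K (lefschetzLieAlgebra K h (LinearMap.range ρ₁)) :=
    inferInstanceAs (FiniteDimensional K (lefschetzLieAlgebra K h (LinearMap.range ρ₁)).toSubmodule)
  haveI : FiniteDimensional K (lefschetzLieAlgebra K h' (LinearMap.range ρ₂)) :=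
    inferInstanceAs (FiniteDimensional K (lefschetzLieAlgebra K h' (LinearMap.range ρ₂)).toSubmodule)
  have T₁ := A₁.isLefschetzTriple
  have T₂ := A₂.isLefschetzTriple
  have h𝔠₁ := map_fst_range_prod_toLefschetzLieAlgebra h h' ρ₁ ρ₂
  have h𝔠₂ := map_snd_range_prod_toLefschetzLieAlgebra h h' ρ₁ ρ₂
  obtain ⟨c, hc⟩ := nonempty_lefschetzDomain_common T₁ T₂ h𝔠₁ h𝔠₂
  obtain ⟨hc𝔠, ⟨-, f₁, t₁⟩, ⟨-, f₂, t₂⟩⟩ := (mem_lefschetzDomain_common_iff T₁ T₂ h𝔠₁ h𝔠₂).1 hc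
  obtain ⟨a, ha⟩ := LinearMap.mem_range.1 hc𝔠
  refine ⟨a, ?_, ?_⟩
  · have t₁' : IsSl2Triple h (ρ₁ a) (f₁ : Module.End K M) := by
      have e1 : (c.1 : Module.End K M) = ρ₁ a := by rw [← ha]; rfl
      rw [← e1]
      exact isSl2Triple_coe_iff.2 t₁
    exact hasLefschetzProperty_of_isSl2Triple A₁.isZGrading t₁'
  · have t₂' : IsSl2Triple h' (ρ₂ a) (f₂ : Module.End K N) := by
      have e2 : (c.2 : Module.End K N) = ρ₂ a := by rw [← ha]; rfl
      rw [← e2]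
      exact isSl2Triple_coe_iff.2 t₂
    exact hasLefschetzProperty_of_isSl2Triple A₂.isZGrading t₂'

end Tensor

/-! ### §5 Morphisms of Lefschetz `𝔞`-modules intertwine the common Lie algebra ("as Lefschetz `𝔞`-modules") -/

section Morphisms

variable {K : Type*} [Field K] [CharZero K] {A : Type*} [AddCommGroup A] [Module K A]
  {M N : Type*} [AddCommGroup M] [Module K M] [FiniteDimensional K M] [AddCommGroup N] [Module K N]
  [FiniteDimensional K N] {h : Module.End K M} {h' : Module.End K N}
  {ρ₁ : A →ₗ[K] Module.End K M} {ρ₂ : A →ₗ[K] Module.End K N}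

omit [CharZero K] [FiniteDimensional K M] [FiniteDimensional K N] in
/-- The graph operator `J(m', m'') = (0, φ m')` of a linear map `φ : M' → M''` commutes with `x' ⊕ x''` iff
`φ x' = x'' φ`. [cite: LooijengaLunts1997, §1 (1.2) p0004 L98–L100 ("as Lefschetz 𝔞-modules"), (1.6) proof p0006 L3–L5] -/
theorem commute_inr_comp_fst_prodMap_iff (φ : M →ₗ[K] N) (x : Module.End K M) (y : Module.End K N) :
    Commute ((LinearMap.inr K M N) ∘ₗ φ ∘ₗ (LinearMap.fst K M N)) (x.prodMap y) ↔ φ ∘ₗ x = y ∘ₗ φ := by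
  constructor
  · intro hc
    ext m
    have h1 := congrArg (fun g : Module.End K (M × N) ↦ (g (m, 0)).2) hc.eq
    simpa using h1
  · intro hφ
    have hφ' : ∀ m, φ (x m) = y (φ m) := fun m ↦ LinearMap.congr_fun hφ m
    ext m <;> simp [hφ']

omit [CharZero K] [FiniteDimensional K M] [FiniteDimensional K N] in
/-- `h' ⊕ h''` is not `0` when `h' ≠ 0`. [cite: LooijengaLunts1997, §1 p0004 L72–L79] -/
theorem prodMap_ne_zero_of_ne_zero_left (hh : h ≠ 0) : h.prodMap h' ≠ 0 := by
  intro h0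
  apply hh
  ext m
  simpa using congrArg (fun g : Module.End K (M × N) ↦ (g (m, 0)).1) h0

/-- **The grading-free naturality of the `𝔰𝔩₂`-partner.**  If `φ : M' → M''` satisfies `φ h' = h'' φ` and
`φ e' = e'' φ` for `𝔰𝔩₂`-triples `(e', h', f')` of `𝔤𝔩(M')` and `(e'', h'', f'')` of `𝔤𝔩(M'')`, then `φ f' = f'' φ`
("This `f` is then unique" made functorial): the graph operator `J` of `φ` commutes with `h' ⊕ h''` and `e' ⊕ e''`,
hence (A1-96 `commute_of_isSl2Triple_of_commute`) with the partner `f' ⊕ f''` of the direct-sum triple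
(`isSl2Triple_prodMap`).  The tree's `comp_dual_eq_dual_comp_of_isSl2Triple` (`Sl2Intertwiner.lean`) is the same
conclusion under the additional hypotheses that `h'`, `h''` are `ℤ`-gradings; none is needed.
[cite: LooijengaLunts1997, §1 (1.1) p0004 L1–L5 ("This f is then unique"), (1.6) proof p0006 L3–L5] -/
theorem comp_eq_comp_of_isSl2Triple_of_comp_eq {e₁ f₁ : Module.End K M} {e₂ f₂ : Module.End K N}
    (t₁ : IsSl2Triple h e₁ f₁) (t₂ : IsSl2Triple h' e₂ f₂) {φ : M →ₗ[K] N} (hφh : φ ∘ₗ h = h' ∘ₗ φ)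
    (hφe : φ ∘ₗ e₁ = e₂ ∘ₗ φ) : φ ∘ₗ f₁ = f₂ ∘ₗ φ :=
  (commute_inr_comp_fst_prodMap_iff φ f₁ f₂).1 (commute_of_isSl2Triple_of_commute (isSl2Triple_prodMap t₁ t₂)
    ((commute_inr_comp_fst_prodMap_iff φ h h').2 hφh) ((commute_inr_comp_fst_prodMap_iff φ e₁ e₂).2 hφe))

/-- **A morphism of Lefschetz `𝔞`-modules intertwines the whole Lie algebra `𝔤(𝔞, M' ⊕ M'')`.**  Let `𝔞` act on `M'`,
`M''` by `e'_a = ρ₁ a`, `e''_a = ρ₂ a`, and let `φ : M' → M''` be linear with `φ h' = h'' φ` and `φ e'_a = e''_a φ` for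
all `a` (a morphism of graded `𝔞`-modules).  Then EVERY element `x' ⊕ x''` of `𝔤(𝔞, M' ⊕ M'')` satisfies `φ x' = x'' φ`:
the graph operator `J(m', m'') = (0, φ m')` commutes with `h' ⊕ h''` and with each `e'_a ⊕ e''_a`, hence with all of
`𝔤(𝔞, M' ⊕ M'')` ("the image of `𝔞` … is normalized by `J`. So the same is true for `𝔤(𝔞, M)`", A1-96
`commute_of_mem_lefschetzLieAlgebra`).  No Lefschetz hypothesis is needed for this form.
[cite: LooijengaLunts1997, §1 (1.2) p0004 L98–L100 ("M ≅ M′ ⊗ M″ as Lefschetz 𝔞-modules with 𝔤′ resp. 𝔤″ corresponding to 𝔤(𝔞, M′) resp. 𝔤(𝔞, M″)"), (1.6) proof p0006 L3–L5] -/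
theorem comp_eq_comp_of_prodMap_mem_lefschetzLieAlgebra_diagProd {φ : M →ₗ[K] N} (hφh : φ ∘ₗ h = h' ∘ₗ φ)
    (hφ : ∀ a : A, φ ∘ₗ ρ₁ a = ρ₂ a ∘ₗ φ) {x : Module.End K M} {y : Module.End K N}
    (hxy : x.prodMap y ∈ lefschetzLieAlgebra K (h.prodMap h') (LinearMap.range (diagProdRep ρ₁ ρ₂))) :
    φ ∘ₗ x = y ∘ₗ φ := by
  refine (commute_inr_comp_fst_prodMap_iff φ x y).1 (commute_of_mem_lefschetzLieAlgebra
    ((commute_inr_comp_fst_prodMap_iff φ h h').2 hφh) ?_ hxy)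
  rintro _ ⟨a, rfl⟩
  rw [diagProdRep_apply]
  exact (commute_inr_comp_fst_prodMap_iff φ (ρ₁ a) (ρ₂ a)).2 (hφ a)

/-- **… hence the whole common Lie algebra `𝔤(𝔠, ·) ≤ 𝔤(𝔞, M') × 𝔤(𝔞, M'')`** (the Lefschetz triple of A1-140, whose
image under `(x', x'') ↦ x' ⊕ x''` is `𝔤(𝔞, M' ⊕ M'')`, §3): for Lefschetz modules `(𝔞, M')`, `(𝔞, M'')` and a morphism
`φ` of Lefschetz `𝔞`-modules, every `(x', x'') ∈ 𝔤(𝔠, ·)` has `φ x' = x'' φ` — `φ` is a morphism of `𝔤(𝔠, ·)`-modules, so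
"isomorphic as Lefschetz `𝔞`-modules" entails "isomorphic as modules over the common Lie algebra".
[cite: LooijengaLunts1997, §1 (1.2) p0004 L98–L100, (1.6) proof p0006 L3–L5] -/
theorem IsLefschetzModule.comp_eq_comp_of_mem_lefschetzLieAlgebra_common (A₁ : IsLefschetzModule K h (LinearMap.range ρ₁))
    (A₂ : IsLefschetzModule K h' (LinearMap.range ρ₂)) {φ : M →ₗ[K] N} (hφh : φ ∘ₗ h = h' ∘ₗ φ)
    (hφ : ∀ a : A, φ ∘ₗ ρ₁ a = ρ₂ a ∘ₗ φ)
    {d : lefschetzLieAlgebra K h (LinearMap.range ρ₁) × lefschetzLieAlgebra K h' (LinearMap.range ρ₂)}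
    (hd : d ∈ lefschetzLieAlgebra K ((⟨h, A₁.h_mem⟩, ⟨h', A₂.h_mem⟩) : lefschetzLieAlgebra K h (LinearMap.range ρ₁) ×
        lefschetzLieAlgebra K h' (LinearMap.range ρ₂))
      (LinearMap.range ((toLefschetzLieAlgebra h ρ₁).prod (toLefschetzLieAlgebra h' ρ₂)))) :
    φ ∘ₗ (d.1 : Module.End K M) = (d.2 : Module.End K N) ∘ₗ φ := by
  refine comp_eq_comp_of_prodMap_mem_lefschetzLieAlgebra_diagProd hφh hφ ?_
  rw [show lefschetzLieAlgebra K (h.prodMap h') (LinearMap.range (diagProdRep ρ₁ ρ₂)) = _ from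
    A₁.lefschetzLieAlgebra_diagProd_eq A₂, LieSubalgebra.mem_map]
  exact ⟨d, hd, rfl⟩

/-- In particular (the first projection of `𝔤(𝔠, ·)` is ONTO `𝔤(𝔞, M')`): every `x' ∈ 𝔤(𝔞, M')` has a companion
`x'' ∈ 𝔤(𝔞, M'')` with `φ x' = x'' φ`; so `φ` maps `𝔤(𝔞, M')`-stable subspaces… compatibly and `ker φ` is
`𝔤(𝔞, M')`-stable. [cite: LooijengaLunts1997, §1 (1.2) p0004 L98–L100, p0004 L69–L70] -/
theorem IsLefschetzModule.exists_comp_eq_comp (A₁ : IsLefschetzModule K h (LinearMap.range ρ₁))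
    (A₂ : IsLefschetzModule K h' (LinearMap.range ρ₂)) {φ : M →ₗ[K] N} (hφh : φ ∘ₗ h = h' ∘ₗ φ)
    (hφ : ∀ a : A, φ ∘ₗ ρ₁ a = ρ₂ a ∘ₗ φ) {x : Module.End K M} (hx : x ∈ lefschetzLieAlgebra K h (LinearMap.range ρ₁)) :
    ∃ y ∈ lefschetzLieAlgebra K h' (LinearMap.range ρ₂), φ ∘ₗ x = y ∘ₗ φ := by
  obtain ⟨y, hy, hxy⟩ := A₁.exists_prodMap_mem_lefschetzLieAlgebra_diagProd A₂ hx
  exact ⟨y, hy, comp_eq_comp_of_prodMap_mem_lefschetzLieAlgebra_diagProd hφh hφ hxy⟩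

/-- … and symmetrically (the second projection is ONTO `𝔤(𝔞, M'')`): every `x'' ∈ 𝔤(𝔞, M'')` has a companion
`x' ∈ 𝔤(𝔞, M')` with `φ x' = x'' φ`; so the image of `φ` is `𝔤(𝔞, M'')`-stable.
[cite: LooijengaLunts1997, §1 (1.2) p0004 L98–L100, p0004 L69–L70] -/
theorem IsLefschetzModule.exists_comp_eq_comp' (A₁ : IsLefschetzModule K h (LinearMap.range ρ₁))
    (A₂ : IsLefschetzModule K h' (LinearMap.range ρ₂)) {φ : M →ₗ[K] N} (hφh : φ ∘ₗ h = h' ∘ₗ φ)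
    (hφ : ∀ a : A, φ ∘ₗ ρ₁ a = ρ₂ a ∘ₗ φ) {y : Module.End K N} (hy : y ∈ lefschetzLieAlgebra K h' (LinearMap.range ρ₂)) :
    ∃ x ∈ lefschetzLieAlgebra K h (LinearMap.range ρ₁), φ ∘ₗ x = y ∘ₗ φ := by
  obtain ⟨x, hx, hxy⟩ := A₁.exists_prodMap_mem_lefschetzLieAlgebra_diagProd' A₂ hy
  exact ⟨x, hx, comp_eq_comp_of_prodMap_mem_lefschetzLieAlgebra_diagProd hφh hφ hxy⟩

/-- **The kernel of a morphism of Lefschetz `𝔞`-modules is a `𝔤(𝔞, M')`-submodule** (from `exists_comp_eq_comp`: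
`x'' (φ m) = φ (x' m)`), cf. "irreducible as a Lefschetz module iff irreducible as a `𝔤(𝔞, M)`-module".
[cite: LooijengaLunts1997, §1 (1.2) p0004 L69–L70, L98] -/
theorem IsLefschetzModule.apply_mem_ker_of_mem_lefschetzLieAlgebra (A₁ : IsLefschetzModule K h (LinearMap.range ρ₁))
    (A₂ : IsLefschetzModule K h' (LinearMap.range ρ₂)) {φ : M →ₗ[K] N} (hφh : φ ∘ₗ h = h' ∘ₗ φ)
    (hφ : ∀ a : A, φ ∘ₗ ρ₁ a = ρ₂ a ∘ₗ φ) {x : Module.End K M} (hx : x ∈ lefschetzLieAlgebra K h (LinearMap.range ρ₁))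
    {m : M} (hm : m ∈ LinearMap.ker φ) : x m ∈ LinearMap.ker φ := by
  obtain ⟨y, -, hxy⟩ := A₁.exists_comp_eq_comp A₂ hφh hφ hx
  rw [LinearMap.mem_ker] at hm ⊢
  rw [← LinearMap.comp_apply, hxy, LinearMap.comp_apply, hm, map_zero]

/-- **The image of a morphism of Lefschetz `𝔞`-modules is a `𝔤(𝔞, M'')`-submodule** (from `exists_comp_eq_comp'`).
[cite: LooijengaLunts1997, §1 (1.2) p0004 L69–L70, L98] -/
theorem IsLefschetzModule.apply_mem_range_of_mem_lefschetzLieAlgebra (A₁ : IsLefschetzModule K h (LinearMap.range ρ₁))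
    (A₂ : IsLefschetzModule K h' (LinearMap.range ρ₂)) {φ : M →ₗ[K] N} (hφh : φ ∘ₗ h = h' ∘ₗ φ)
    (hφ : ∀ a : A, φ ∘ₗ ρ₁ a = ρ₂ a ∘ₗ φ) {y : Module.End K N} (hy : y ∈ lefschetzLieAlgebra K h' (LinearMap.range ρ₂))
    {n : N} (hn : n ∈ LinearMap.range φ) : y n ∈ LinearMap.range φ := by
  obtain ⟨x, -, hxy⟩ := A₁.exists_comp_eq_comp' A₂ hφh hφ hy
  obtain ⟨m, rfl⟩ := hn
  exact ⟨x m, by rw [← LinearMap.comp_apply, hxy, LinearMap.comp_apply]⟩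

end Morphisms

end Literature.Algebra.Lie
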